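import Mathlib
import Literature.Combinatorics.Hinz2018.HanoiGraphsHpLargestDiscMoves
import Literature.Combinatorics.Hinz2018.RegularToRegularGeodesics

/-!
# Hinz–Klavžar–Petr (2018), Ch. 5 §5.7.2, Theorem 5.68 (Aumann) — the three-peg case, proved

Combinatorics/Hinz2018 support file (theorem-only). The named fact
`Literature.Combinatorics.Hinz2018.AumannLDMTheorem p` (`Hinz2018/HanoiGraphsHpLargestDiscMoves`,
Theorem 5.68: «If $n \in \mathbb{N}_{p(p-2)}$, then p-1 LDMs are necessary for some P2-type tasks.»)
is stated for every number of pegs `p ≥ 3`; its printed proof (Aumann–Götz–Hinz–Petr 2014, by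
explicit tasks and an extra-move count) is not in the tree. THIS FILE PROVES THE CASE `p = 3`,
`aumannLDMTheorem_three : AumannLDMTheorem 3`: for every `n + 1 ≥ 3 = 3·(3-2)` discs the task
«largest disc on peg `0`, the `n`-tower of the smaller discs on peg `2`» → «largest disc on peg `2`,
the tower on peg `0`» has TWO moves of the largest disc on every shortest solution — the book's
Figure 2.26 («Shortest path needs two LDMs in $H_3^3$», Ch. 2 §2.4, the transposition of the
largest disc and the 2-tower; in the tree `figure_2_26_count`) with more discs, and the base task
`022 → 200` of the printed proof of Theorem 5.68 for `p = 3`.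

The proof is the book's Theorem 2.38 analysis, all of it already in the tree
(`Hinz2018/RegularToRegular`, `Hinz2018/RegularToRegularGeodesics`): for the task `is → jt`,
`i ≠ j`, a shortest walk moves the largest disc once, with length `d_1 = d(s,k^n) + 1 + d(t,k^n)`,
or twice, with length `d_2 = d(s,j^n) + 2^n + 1 + d(t,i^n)` (`theorem_2_38_candidates`), and
`d(is, jt) = min {d_1, d_2}` (`hanoiDist_snoc_snoc_of_ne`). For `s = j^n`, `t = i^n` one gets
`d_1 = 2^{n+1} - 1` and `d_2 = 2^n + 1` (`distOnce_towerSwap`, `distTwice_towerSwap`), so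
`d_2 < d_1` as soon as `n ≥ 2`, and every shortest walk has two LDMs. The only new tool is the
identification `largeDiscMoves_eq_ldmCount` of Ch. 5's LDM count `largeDiscMoves` (on
`hanoiGraphP 3 (n + 1)`, which is `hanoiGraph (n + 1)` by `rfl`) with Ch. 2's `ldmCount`.

No new definition, no new named fact; `AumannLDMTheorem p` for `p ≥ 4` remains a named fact.

## References

* A. M. Hinz, S. Klavžar, C. Petr, *The Tower of Hanoi — Myths and Maths*, 2nd ed., Birkhäuser
  2018, Ch. 2 §2.4 (Fig. 2.26, Thm. 2.38) and Ch. 5 §5.7.2 (Thm. 5.67, Thm. 5.68, p. 278–279).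
  [HinzKlavzarPetr2018]
* S. Aumann, K. A. M. Götz, A. M. Hinz, C. Petr, *The number of moves of the largest disc in
  shortest paths on Hanoi graphs*, Electron. J. Combin. 21 (2014) P4.38, §2 (proof of the theorem
  for `n = p(p-2)`: «For p = 3 and n_3 = 3, let (s, t) = (022, 200)»). (The book's [24]; quoted for
  the choice of the task, not cited as a key.)
-/

namespace Literature.Combinatorics.Hinz2018

open Finset

/-! ## Ch. 5's LDM count on three pegs is Ch. 2's -/

/-- On three pegs (`hanoiGraphP 3 (n + 1) = hanoiGraph (n + 1)`, `rfl`) the number of moves of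
the largest disc of Ch. 5 §5.2 (`largeDiscMoves`, a count of darts) is the LDM count `ldmCount`
of Ch. 2 §2.4 (a recursion on the walk): both add `1` exactly at the steps moving disc `n + 1`.
[cite: HinzKlavzarPetr2018, Ch. 2 §2.4 Lemma 2.32, Cor. 2.37] -/
theorem largeDiscMoves_eq_ldmCount {n : ℕ} {u v : Fin (n + 1) → ZMod 3}
    (W : (hanoiGraph (n + 1)).Walk u v) : largeDiscMoves (p := 3) W = ldmCount W := by
  induction W with
  | nil => rfl
  | @cons u w v h W ih =>
    -- term mode on purpose: `hanoiGraphP 3 (n + 1) = hanoiGraph (n + 1)` and `Fin 3 = ZMod 3` hold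
    -- by unfolding only, so the two counts are compared through `Eq.trans`, not by rewriting
    exact (largeDiscMoves_cons (p := 3) h W).trans
      ((congrArg (fun m => (if u (Fin.last n) = w (Fin.last n) then 0 else 1) + m) ih).trans
        (ldmCount_cons h W).symm)

/-! ## The two candidate lengths for the tower swap `i j^n → j i^n` -/

/-- `d_1(i j^n, j i^n) = d(j^n, k^n) + 1 + d(i^n, k^n) = 2^{n+1} - 1` (`k = 3 - i - j`): solving
the tower swap with ONE move of the largest disc costs two full tower transfers and that move.
[cite: HinzKlavzarPetr2018, Ch. 2 §2.4 Thm. 2.38 (proof), Algorithm 12 (μ_1, μ_2)] -/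
theorem distOnce_towerSwap {n : ℕ} {i j : ZMod 3} (hij : i ≠ j) :
    distOnce n (perfectWord n j) (perfectWord n i) i j = 2 ^ (n + 1) - 1 := by
  have hKi : thirdPeg i j ≠ i := (thirdPeg_spec i j hij).1
  have hKj : thirdPeg i j ≠ j := (thirdPeg_spec i j hij).2.1
  unfold distOnce
  rw [p1Dist_stateOf_perfectWord, p1Dist_stateOf_perfectWord, if_neg hKj.symm, if_neg hKi.symm,
    pow_succ]
  have h1 : 1 ≤ 2 ^ n := Nat.one_le_two_pow
  omega

/-- `d_2(i j^n, j i^n) = d(j^n, j^n) + 2^n + 1 + d(i^n, i^n) = 2^n + 1`: with TWO moves of the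
largest disc the smaller tower moves once, across the largest disc.
[cite: HinzKlavzarPetr2018, Ch. 2 §2.4 Thm. 2.38 (proof), Algorithm 12 (μ_1, μ_2)] -/
theorem distTwice_towerSwap (n : ℕ) (i j : ZMod 3) :
    distTwice n (perfectWord n j) (perfectWord n i) i j = 2 ^ n + 1 := by
  unfold distTwice
  rw [p1Dist_stateOf_perfectWord, p1Dist_stateOf_perfectWord, if_pos rfl, if_pos rfl]
  omega

/-- The distance of the tower swap with at least two smaller discs: `d(i j^n, j i^n) = 2^n + 1`
(`= d_2 < d_1 = 2^{n+1} - 1` for `n ≥ 2`; for `n = 1` both are `3`, Figure 2.25, and for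
`n = 2` this is Figure 2.26's `5 < 7`).
[cite: HinzKlavzarPetr2018, Ch. 2 §2.4 Fig. 2.26, text before Thm. 2.38] -/
theorem hanoiDist_towerSwap {n : ℕ} (hn : 2 ≤ n) {i j : ZMod 3} (hij : i ≠ j) :
    (hanoiGraph (n + 1)).dist (Fin.snoc (perfectWord n j) i : Fin (n + 1) → ZMod 3)
      (Fin.snoc (perfectWord n i) j) = 2 ^ n + 1 := by
  rw [hanoiDist_snoc_snoc_of_ne hij, distOnce_towerSwap hij, distTwice_towerSwap]
  have h4 : 4 ≤ 2 ^ n := by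
    calc (4 : ℕ) = 2 ^ 2 := by norm_num
      _ ≤ 2 ^ n := Nat.pow_le_pow_right (by norm_num) hn
  rw [pow_succ]
  omega

/-- **Two LDMs are necessary** for the tower swap `i j^n → j i^n` with `n ≥ 2` smaller discs:
every shortest walk moves the largest disc exactly twice (Theorem 2.38's dichotomy: a shortest
walk with one LDM would have length `d_1 = 2^{n+1} - 1 > 2^n + 1 = d`).
[cite: HinzKlavzarPetr2018, Ch. 2 §2.4 Fig. 2.26, text before Thm. 2.38] -/
theorem ldmCount_eq_two_of_towerSwap {n : ℕ} (hn : 2 ≤ n) {i j : ZMod 3} (hij : i ≠ j)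
    (W : (hanoiGraph (n + 1)).Walk (Fin.snoc (perfectWord n j) i : Fin (n + 1) → ZMod 3)
      (Fin.snoc (perfectWord n i) j))
    (hW : W.length = (hanoiGraph (n + 1)).dist (Fin.snoc (perfectWord n j) i : Fin (n + 1) → ZMod 3)
      (Fin.snoc (perfectWord n i) j)) :
    ldmCount W = 2 := by
  have hd := hanoiDist_towerSwap hn hij
  have h4 : 4 ≤ 2 ^ n := by
    calc (4 : ℕ) = 2 ^ 2 := by norm_num
      _ ≤ 2 ^ n := Nat.pow_le_pow_right (by norm_num) hn
  rcases theorem_2_38_candidates hij W hW with ⟨-, hl, -⟩ | ⟨c, -, -⟩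
  · rw [distOnce_towerSwap hij, hW, hd, pow_succ] at hl
    omega
  · exact c

/-! ## Theorem 5.68 for three pegs -/

/-- **Theorem 5.68 (Aumann) for `p = 3`, PROVED**: for every `n + 1 ≥ 3 = 3·(3-2)` discs the
P2-type task «largest disc on peg `0` and the other `n` discs on peg `2`» → «largest disc on peg
`2` and the others on peg `0`» (the task `022 → 200` of the printed proof, with more small discs)
needs `2 = 3 - 1` moves of the largest disc on EVERY shortest solution; so the named fact
`AumannLDMTheorem 3` holds (the case `p ≥ 4` stays a named fact).
[cite: HinzKlavzarPetr2018, Ch. 5 §5.7.2 Thm. 5.68, p. 279] -/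
theorem aumannLDMTheorem_three : AumannLDMTheorem 3 := by
  intro _ n hn
  have hn2 : 2 ≤ n := by omega
  have h02 : (0 : ZMod 3) ≠ 2 := by decide
  refine ⟨(Fin.snoc (perfectWord n 2) 0 : Fin (n + 1) → ZMod 3),
    (Fin.snoc (perfectWord n 0) 2 : Fin (n + 1) → ZMod 3), fun W hW => ?_⟩
  -- `W` is a walk of `hanoiGraphP 3 (n + 1) = hanoiGraph (n + 1)` (`rfl`); term mode as above
  exact (largeDiscMoves_eq_ldmCount W).trans (ldmCount_eq_two_of_towerSwap hn2 h02 W hW)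

/-- With Theorem 5.67 (`largeDiscMoves_le_two_of_three`): on three pegs and at least three discs
the maximal number `2` of LDMs on a shortest path is attained — some shortest walk of
`H_3^{n+1}`, `n ≥ 2`, moves the largest disc exactly twice.
[cite: HinzKlavzarPetr2018, Ch. 5 §5.7.2 Thm. 5.68, p. 279] -/
theorem exists_geodesic_largeDiscMoves_eq_two {n : ℕ} (hn : 2 ≤ n) :
    ∃ (s t : Fin (n + 1) → Fin 3) (W : (hanoiGraphP 3 (n + 1)).Walk s t),
      W.length = (hanoiGraphP 3 (n + 1)).dist s t ∧ largeDiscMoves W = 2 :=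
  exists_geodesic_largeDiscMoves_eq aumannLDMTheorem_three le_rfl (by omega)

end Literature.Combinatorics.Hinz2018
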